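import Mathlib
import Summits.NavierStokesRegularity.NavierStokesRegularity.Theorems.EulerZoomLiouvillePowerGaugeEulerLiouvilleSelfSimilarOffRate
import Summits.NavierStokesRegularity.NavierStokesRegularity.Theorems.EulerZoomLiouvillePowerGaugeEulerLiouvilleSelfSimilarOffRatePastGrowth
import HarnessLib

/-!
# RATE RIGIDITY for PAST-EXACT / SHIFTED self-similar members: a collapse about ANY space–time point `(T, x₀)` on a past sub-slab
# `τ < T₁` at a rate `g ∈ (γ, ½)`, `γ = 1/(2+ρ)`, is trivial — weak class, no profile hypothesis
# (crux `EulerZoomLiouville.PowerGaugeEulerLiouville` = stmt-NavierStokesRegularity-19832; sequel of `…SelfSimilarOffRate`)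

Route `EulerZoomLiouville` (NavierStokesRegularity); width seat ns-ezl-w4 g2.  `…SelfSimilarOffRate` closed the exponent window for members
exactly self-similar about the space–time origin on the whole slab.  Here the same RATE RIGIDITY is proved for members that are exactly
self-similar about an arbitrary point `(T, x₀)` and only on a far past `τ < T₁` (`T₁ ≤ 0`, `T₁ ≤ T`; arbitrary on `[T₁, 0)`):
`u(τ, x) = (T−τ)^{g−1} W((T−τ)^{−g}(x − x₀))`, `p(τ, x) = (T−τ)^{2(g−1)} P((T−τ)^{−g}(x − x₀))` for `τ < T₁`, with `1/(2+ρ) < g < ½` ⇒ `u = 0`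
a.e. on the whole slab.  The chain is that of `OffRate.exists_locData` with the PAST dictionary of ns-ezl-w1 / the interim LEAD, all of which is
`γ`-general: the origin-centred extension `Shifted.isDistributional_selfSimilarCollapse_of_past`, the profile gradient
`Past.exists_profileGradient_ae_of_past`, the bricks `Past.profile_gradient_growth_of_gaugeE_past` / `…pressure_growth_of_gaugeD_past` (applied with
the fictitious exponent `ρ' = 1/g − 2` to the gradient and pressure truncated to `τ < min(T₁, −1)`, `OffRate.gaugeE_cut` / `gaugeD_cut`), and the
one-slice `A`-growth at rate `g` (`OffRate.profile_energy_growth_of_gaugeA_past_rate`, file `…SelfSimilarOffRatePastGrowth`: the far-past slice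
`τ = T₁ − 1`).  Sub-extremality in the `ρ'`-normalisation is again automatic (`g > γ ⟺ ρ' < ρ`),
`EnergySaturation.ae_eq_zero_of_subExtremal_loc (ρ := ρ')` gives `W = 0` a.e., and `Past.ae_eq_zero_of_profile_ae_eq_zero` the member.

* `OffRate.exists_locData_past` — the `ρ'`-shaped large-scale profile data of a past-exact rate-`g` member;
* `OffRate.selfSimilar_ae_eq_zero_of_rate_window_past` — MEMBER LEVEL: crux hypotheses verbatim (`0 < ρ ≤ ½`) + past-exact self-similarity about
  `(T, x₀)` at a rate `g ∈ (1/(2+ρ), ½)` ⇒ `u = 0` a.e.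

WHAT THIS IS NOT: not NS, not E — a stratum of the crux CLASS 19832 on the MODEL lattice, `--supports` stmt-19832.  Slow rates `g < γ` about `T > 0`
and the class rate stay in the residue. [folklore; cf. BronziShvydkoy2015 Thm 1.1]
-/

noncomputable section

-- flat `Theorems/<Route><Decl>…` files of one crux share the namespace of the crux (tree convention: `Summit.<S>.<S>.…`)
set_option linter.dupNamespace false

open MeasureTheory Set Filter Topology Metric Function TopologicalSpace
open scoped ENNReal NNReal InnerProductSpace RealInnerProductSpace Laplacian

namespace Summit.NavierStokesRegularity.NavierStokesRegularity.Theorems.PowerGaugeEulerLiouville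

open Literature.Analysis Literature.Analysis.FunctionSpaces Literature.Analysis.FluidPDE

namespace OffRate

variable {ρ g T T₁ : ℝ} {x₀ : EuclideanSpace ℝ (Fin 3)}
  {u : ℝ → EuclideanSpace ℝ (Fin 3) → EuclideanSpace ℝ (Fin 3)} {p : ℝ → EuclideanSpace ℝ (Fin 3) → ℝ}
  {H : ℝ → EuclideanSpace ℝ (Fin 3) → EuclideanSpace ℝ (Fin 3) →L[ℝ] EuclideanSpace ℝ (Fin 3)} {c : ℝ≥0}
  {W : EuclideanSpace ℝ (Fin 3) → EuclideanSpace ℝ (Fin 3)} {P : EuclideanSpace ℝ (Fin 3) → ℝ}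

/-! ### The `ρ'`-shaped large-scale profile data of a past-exact off-rate member -/

/-- **The profile data of a PAST-EXACT rate-`g` member in the shapes of the fictitious class `ρ' = 1/g − 2`** (crux hypotheses verbatim,
`0 < ρ ≤ ½`; `(u, p)` exactly self-similar about `(T, x₀)` at rate `g` for `τ < T₁`, `T₁ ≤ 0`, `T₁ ≤ T`, `1/(2+ρ) < g < ½`): the conclusions of
`OffRate.exists_locData` (with a finite `A`-constant `C_A` in place of `2c`). [folklore] -/
theorem exists_locData_past (hρ : 0 < ρ) (hρh : ρ ≤ 1 / 2) (hT₁ : T₁ ≤ 0) (hTT₁ : T₁ ≤ T) (x₀ : EuclideanSpace ℝ (Fin 3))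
    (hsw : IsSuitableWeakSolutionOn (slab (EuclideanSpace ℝ (Fin 3)) (Iio 0) isOpen_Iio) 0 0 u p)
    (hH : HasWeakSpatialGradientOn (slab (EuclideanSpace ℝ (Fin 3)) (Iio 0) isOpen_Iio) u H)
    (hgauge : ∀ a : ℝ, 0 < a →
      ENNReal.ofReal (a ^ (2 * ρ)) * cknA a (0 : ℝ × EuclideanSpace ℝ (Fin 3)) u +
          ENNReal.ofReal (a ^ ρ) * cknE a (0 : ℝ × EuclideanSpace ℝ (Fin 3)) H +
        ENNReal.ofReal (a ^ (2 * ρ)) * cknD a (0 : ℝ × EuclideanSpace ℝ (Fin 3)) p ≤ (c : ℝ≥0∞))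
    (hg1 : 1 / (2 + ρ) < g) (hg2 : g < 1 / 2)
    (hu : ∀ τ : ℝ, τ < T₁ → u τ = fun x => selfSimilarCollapse g T W τ (x - x₀))
    (hp : ∀ τ : ℝ, τ < T₁ → p τ = fun x => selfSimilarCollapsePressure g T P τ (x - x₀)) :
    ∃ (G : EuclideanSpace ℝ (Fin 3) → EuclideanSpace ℝ (Fin 3) →L[ℝ] EuclideanSpace ℝ (Fin 3)) (c' : ℝ≥0) (CA : ℝ≥0∞),
      AEStronglyMeasurable W volume ∧ AEStronglyMeasurable P volume ∧ AEStronglyMeasurable G volume ∧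
      HasWeakFDerivOn (⊤ : Opens (EuclideanSpace ℝ (Fin 3))) volume W G ∧
      (∀ L : ℝ, 1 ≤ L → ∫⁻ y in ball (0 : EuclideanSpace ℝ (Fin 3)) L, ‖W y‖ₑ ^ 2 ≤
        (c' : ℝ≥0∞) * ENNReal.ofReal (L ^ (1 - 2 * (1 / g - 2)))) ∧
      (∀ L : ℝ, 1 ≤ L →
        ∫⁻ y in ball (0 : EuclideanSpace ℝ (Fin 3)) L, ENNReal.ofReal (frobeniusNormSq (G y)) ≤
          ENNReal.ofReal (L ^ (1 - (1 / g - 2))) *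
            (ENNReal.ofReal ((1 - (1 / g - 2)) / (2 + (1 / g - 2))) * (c' : ℝ≥0∞))) ∧
      (∀ L : ℝ, 1 ≤ L →
        ∫⁻ y in ball (0 : EuclideanSpace ℝ (Fin 3)) L, ‖P y‖ₑ ^ (3 / 2 : ℝ) ≤
          ENNReal.ofReal (L ^ (2 - 2 * (1 / g - 2))) *
            (ENNReal.ofReal ((2 - 2 * (1 / g - 2)) / (2 + (1 / g - 2))) * (c' : ℝ≥0∞))) ∧
      (∀ θ : EuclideanSpace ℝ (Fin 3) → ℝ, ContDiff ℝ (⊤ : ℕ∞) θ → HasCompactSupport θ →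
        ∫ y, P y * (Δ θ) y = -∫ y, fderiv ℝ (fderiv ℝ θ) y (W y) (W y)) ∧
      (∀ σ : EuclideanSpace ℝ (Fin 3) → ℝ, IsTestFunctionOn (⊤ : Opens (EuclideanSpace ℝ (Fin 3))) σ →
        (2 - 5 * (1 / (2 + (1 / g - 2)))) * ∫ x, σ x * ‖W x‖ ^ 2 =
          (∫ x, (‖W x‖ ^ 2 + 2 * P x) * ⟪W x, gradient σ x⟫) +
            (1 / (2 + (1 / g - 2))) * ∫ x, ‖W x‖ ^ 2 * ⟪x, gradient σ x⟫) ∧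
      CA ≠ ⊤ ∧
      (∀ L : ℝ, 1 ≤ L → ∫⁻ y in ball (0 : EuclideanSpace ℝ (Fin 3)) L, ‖W y‖ₑ ^ 2 ≤
        CA * ENNReal.ofReal (L ^ (1 - 2 * ρ))) := by
  -- adapted from `OffRate.exists_locData` (…SelfSimilarOffRate) and `Past.profileData_of_past` (…SelfSimilarPastProfileEquations)
  have hρ1 : ρ < 1 := by linarith
  obtain ⟨hρ'0, hρ'ρ, hρ'1, hginv⟩ := exponent_facts hρ hρ1 hg1 hg2
  set ρ' : ℝ := 1 / g - 2 with hρ'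
  have h2ρ' : (0 : ℝ) < 2 + ρ' := by linarith
  have hg0 : 0 ≤ g := by rw [← hginv]; positivity
  -- the three gauges separately
  have hA : ∀ a : ℝ, 0 < a → ENNReal.ofReal (a ^ (2 * ρ)) *
      cknA a (0 : ℝ × EuclideanSpace ℝ (Fin 3)) u ≤ (c : ℝ≥0∞) :=
    fun a ha => le_trans (le_trans le_self_add le_self_add) (hgauge a ha)
  have hE : ∀ a : ℝ, 0 < a → ENNReal.ofReal (a ^ ρ) *
      cknE a (0 : ℝ × EuclideanSpace ℝ (Fin 3)) H ≤ (c : ℝ≥0∞) :=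
    fun a ha => le_trans (le_trans le_add_self le_self_add) (hgauge a ha)
  have hD : ∀ a : ℝ, 0 < a → ENNReal.ofReal (a ^ (2 * ρ)) *
      cknD a (0 : ℝ × EuclideanSpace ℝ (Fin 3)) p ≤ (c : ℝ≥0∞) :=
    fun a ha => le_trans le_add_self (hgauge a ha)
  -- ### the origin-centred extension: a distributional Euler pair on the whole slab (rate `g`)
  have hsol : IsDistributionalNSSolutionOn (slab (EuclideanSpace ℝ (Fin 3)) (Iio 0) isOpen_Iio) 0 0 u p :=
    hsw.distributional
  have hext := Shifted.isDistributional_selfSimilarCollapse_of_past hT₁ hTT₁ x₀ hsol hu hp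
  -- ### measurability
  have hum' : AEStronglyMeasurable (uncurry (selfSimilarCollapse g 0 W))
      (volume.restrict (Iio (0 : ℝ) ×ˢ (univ : Set (EuclideanSpace ℝ (Fin 3))))) := by
    have := hext.1.aestronglyMeasurable
    simpa [slab] using this
  have hpm' : AEStronglyMeasurable (uncurry (selfSimilarCollapsePressure g 0 P))
      (volume.restrict (Iio (0 : ℝ) ×ˢ (univ : Set (EuclideanSpace ℝ (Fin 3))))) := by
    have := hext.2.2.1.aestronglyMeasurable
    simpa [slab] using this
  have hWm : AEStronglyMeasurable W volume :=
    aestronglyMeasurable_profile (u := selfSimilarCollapse g 0 W) (V := W) hum' fun _ _ => rfl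
  have hPm : AEStronglyMeasurable P volume :=
    aestronglyMeasurable_pressureProfile (p := selfSimilarCollapsePressure g 0 P) (P := P) hpm' fun _ _ => rfl
  have hpm : AEStronglyMeasurable (uncurry p)
      (volume.restrict (Iio (0 : ℝ) ×ˢ (univ : Set (EuclideanSpace ℝ (Fin 3))))) := by
    have := hsol.2.2.1.aestronglyMeasurable
    simpa [slab] using this
  have hHm : AEStronglyMeasurable (uncurry H)
      (volume.restrict (Iio (0 : ℝ) ×ˢ (univ : Set (EuclideanSpace ℝ (Fin 3))))) := by
    have := hH.locallyIntegrableOn_grad.aestronglyMeasurable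
    simpa [slab] using this
  -- ### the profile gradient (rate `g`, past form)
  obtain ⟨G, hGm, hWG, hHae⟩ := Past.exists_profileGradient_ae_of_past hH hT₁ hTT₁ x₀ hu
  -- ### truncation at `T₂ = min T₁ (−1)`
  set T₂ : ℝ := min T₁ (-1) with hT₂
  have hT₂1 : T₂ ≤ -1 := min_le_right _ _
  have hT₂T₁ : T₂ ≤ T₁ := min_le_left _ _
  have hT₂0 : T₂ ≤ 0 := hT₂T₁.trans hT₁
  have hT₂T : T₂ ≤ T := hT₂T₁.trans hTT₁
  set H' : ℝ → EuclideanSpace ℝ (Fin 3) → EuclideanSpace ℝ (Fin 3) →L[ℝ] EuclideanSpace ℝ (Fin 3) :=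
    fun τ x => if τ < T₂ then H τ x else 0 with hH'
  set p' : ℝ → EuclideanSpace ℝ (Fin 3) → ℝ := fun τ x => if τ < T₂ then p τ x else 0 with hp'def
  have hH'm : AEStronglyMeasurable (uncurry H')
      (volume.restrict (Iio (0 : ℝ) ×ˢ (univ : Set (EuclideanSpace ℝ (Fin 3))))) :=
    aestronglyMeasurable_uncurry_cut hHm T₂
  have hp'm : AEStronglyMeasurable (uncurry p')
      (volume.restrict (Iio (0 : ℝ) ×ˢ (univ : Set (EuclideanSpace ℝ (Fin 3))))) :=
    aestronglyMeasurable_uncurry_cut hpm T₂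
  have hE' : ∀ a : ℝ, 0 < a → ENNReal.ofReal (a ^ ρ') *
      cknE a (0 : ℝ × EuclideanSpace ℝ (Fin 3)) H' ≤ (c : ℝ≥0∞) := gaugeE_cut hρ'ρ.le hE hT₂1
  have hD' : ∀ a : ℝ, 0 < a → ENNReal.ofReal (a ^ (2 * ρ')) *
      cknD a (0 : ℝ × EuclideanSpace ℝ (Fin 3)) p' ≤ (c : ℝ≥0∞) := gaugeD_cut hρ'ρ.le hD hT₂1
  have hH'ae : ∀ᵐ τ ∂((volume : Measure ℝ).restrict (Iio T₂)),
      H' τ =ᵐ[volume] fun x => (T - τ) ^ (-1 : ℝ) • G ((T - τ) ^ (-(1 / (2 + ρ'))) • (x - x₀)) := by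
    have h1 : ∀ᵐ τ ∂((volume : Measure ℝ).restrict (Iio T₂)),
        H τ =ᵐ[volume] fun x => (T - τ) ^ (-1 : ℝ) • G ((T - τ) ^ (-g) • (x - x₀)) :=
      ae_restrict_of_ae_restrict_of_subset (Iio_subset_Iio hT₂T₁) hHae
    filter_upwards [h1, ae_restrict_mem measurableSet_Iio] with τ hτ hτ1
    have hτ1' : τ < T₂ := hτ1
    have hH'τ : H' τ = H τ := by funext x; simp [hH', hτ1']
    rw [hH'τ, hginv]
    exact hτ
  have hp'rep : ∀ τ : ℝ, τ < T₂ → p' τ = fun x => selfSimilarCollapsePressure (1 / (2 + ρ')) T P τ (x - x₀) := by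
    intro τ hτ
    funext x
    have : p' τ x = p τ x := by simp [hp'def, hτ]
    rw [this, hp τ (lt_of_lt_of_le hτ hT₂T₁), hginv]
  -- ### the large-scale gauge data
  obtain ⟨CA, hCA, hA''⟩ := profile_energy_growth_of_gaugeA_past_rate hρ.le hρh hg0 hT₁ hTT₁ x₀ hu hA
  obtain ⟨CE, hCE, hE''⟩ := Past.profile_gradient_growth_of_gaugeE_past hρ'0 hρ'1 hT₂0 hT₂T x₀ hH'm hH'ae hE'
  obtain ⟨CD, hCD, hD''⟩ := Past.profile_pressure_growth_of_gaugeD_past hρ'0 hρ'1 hT₂0 hT₂T x₀ hp'm hp'rep hD'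
  -- ### integrability on all balls
  have hV2fin : ∀ r : ℝ, ∫⁻ y in ball (0 : EuclideanSpace ℝ (Fin 3)) r, ‖W y‖ₑ ^ 2 < ⊤ :=
    Past.lintegral_ball_lt_top_of_growth hCA hA''
  have hGfin : ∀ r : ℝ, ∫⁻ y in ball (0 : EuclideanSpace ℝ (Fin 3)) r, ENNReal.ofReal (frobeniusNormSq (G y)) < ⊤ :=
    Past.lintegral_ball_lt_top_of_growth hCE hE''
  have hPfin : ∀ r : ℝ, ∫⁻ y in ball (0 : EuclideanSpace ℝ (Fin 3)) r, ‖P y‖ₑ ^ (3 / 2 : ℝ) < ⊤ :=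
    Past.lintegral_ball_lt_top_of_growth hCD hD''
  have hV2R : ∀ r : ℝ, MemLp W 2 (volume.restrict (ball (0 : EuclideanSpace ℝ (Fin 3)) r)) :=
    Past.memLp_two_ball_of_lintegral_lt_top hWm hV2fin
  have hG2R : ∀ r : ℝ, MemLp G 2 (volume.restrict (ball (0 : EuclideanSpace ℝ (Fin 3)) r)) :=
    Past.memLp_two_ball_gradient_of_lintegral_lt_top hGm hGfin
  have hP32R : ∀ r : ℝ, MemLp P (3 / 2 : ℝ≥0∞) (volume.restrict (ball (0 : EuclideanSpace ℝ (Fin 3)) r)) :=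
    Past.memLp_threeHalves_ball_of_lintegral_lt_top hPm hPfin
  have hV6R : ∀ r : ℝ, MemLp W 6 (volume.restrict (ball (0 : EuclideanSpace ℝ (Fin 3)) r)) :=
    Past.memLp_six_ball_of_gradient hWm hWG hV2R hGfin
  -- ### local integrability of `W`, `|W|²`, `P`
  have hVloc : LocallyIntegrable W volume := locallyIntegrableOn_univ.1 (by
    simpa only [Opens.coe_top] using hWG.locallyIntegrableOn)
  have hV2loc : LocallyIntegrable (fun y => ‖W y‖ ^ 2) volume := by
    refine (locallyIntegrable_iff).2 fun K hK => ?_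
    obtain ⟨r, hr⟩ := hK.isBounded.subset_ball (0 : EuclideanSpace ℝ (Fin 3))
    have h := (hV2R r).integrable_norm_pow two_ne_zero
    exact IntegrableOn.mono_set (show IntegrableOn (fun y => ‖W y‖ ^ 2) (ball 0 r) volume from h) hr
  have hPloc : LocallyIntegrable P volume := by
    refine (locallyIntegrable_iff).2 fun K hK => ?_
    obtain ⟨r, hr⟩ := hK.isBounded.subset_ball (0 : EuclideanSpace ℝ (Fin 3))
    haveI : IsFiniteMeasure ((volume : Measure (EuclideanSpace ℝ (Fin 3))).restrict
        (ball (0 : EuclideanSpace ℝ (Fin 3)) r)) :=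
      isFiniteMeasure_restrict.2 measure_ball_lt_top.ne
    have h : IntegrableOn P (ball (0 : EuclideanSpace ℝ (Fin 3)) r) volume :=
      memLp_one_iff_integrable.1 ((hP32R r).mono_exponent (by
        rw [ENNReal.le_div_iff_mul_le (Or.inl (by norm_num)) (Or.inl (by norm_num))]; norm_num))
    exact h.mono_set hr
  -- ### the equations at rate `g`, read off the extension, in the `ρ'`-shape
  have heq := fun (ψ : EuclideanSpace ℝ (Fin 3) → EuclideanSpace ℝ (Fin 3))
      (hψ : IsTestFunctionOn (⊤ : Opens (EuclideanSpace ℝ (Fin 3))) ψ) =>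
    ProfileEquation.weak_profile_equation hext (fun _ _ => rfl) (fun _ _ => rfl) hVloc hV2loc hPloc hψ
  have hdiv : IsWeaklyDivFree W := ProfileEquation.profile_isWeaklyDivFree hext (fun _ _ => rfl) hVloc
  have hPoisson : ∀ θ : EuclideanSpace ℝ (Fin 3) → ℝ, ContDiff ℝ (⊤ : ℕ∞) θ → HasCompactSupport θ →
      ∫ y, P y * (Δ θ) y = -∫ y, fderiv ℝ (fderiv ℝ θ) y (W y) (W y) :=
    fun θ hθ hθc => Past.profile_pressure_poisson_of_distributional hext hum' (fun _ _ => rfl) (fun _ _ => rfl)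
      hV2loc hPloc hθ hθc
  have hEEg := fun (σ : EuclideanSpace ℝ (Fin 3) → ℝ)
      (hσ : IsTestFunctionOn (⊤ : Opens (EuclideanSpace ℝ (Fin 3))) σ) =>
    ProfileEnergy.profile_local_energy_equality hWG hV6R hG2R hPm hP32R hdiv heq hσ
  have hEE : ∀ σ : EuclideanSpace ℝ (Fin 3) → ℝ, IsTestFunctionOn (⊤ : Opens (EuclideanSpace ℝ (Fin 3))) σ →
      (2 - 5 * (1 / (2 + ρ'))) * ∫ x, σ x * ‖W x‖ ^ 2 =
        (∫ x, (‖W x‖ ^ 2 + 2 * P x) * ⟪W x, gradient σ x⟫) +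
          (1 / (2 + ρ')) * ∫ x, ‖W x‖ ^ 2 * ⟪x, gradient σ x⟫ := by
    intro σ hσ
    rw [hginv]
    exact hEEg σ hσ
  -- ### thresholds to `L ≥ 1` and ONE common constant in the shapes (A₁), (E₁), (D₁)
  have hL₀A : (1 : ℝ) ≤ 2 - T₁ := by linarith
  have hL₀ : (1 : ℝ) ≤ 2 - T₂ := by linarith
  have hA1ρ := Past.growth_ge_one_of_growth_ge hL₀A (by linarith : (0 : ℝ) ≤ 1 - 2 * ρ) hA''
  have hE1 := Past.growth_ge_one_of_growth_ge hL₀ (by linarith : (0 : ℝ) ≤ 1 - ρ') hE''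
  have hD1 := Past.growth_ge_one_of_growth_ge hL₀ (by linarith : (0 : ℝ) ≤ 2 - 2 * ρ') hD''
  set CA' : ℝ≥0∞ := CA * ENNReal.ofReal ((2 - T₁) ^ (1 - 2 * ρ)) with hCA'
  have hCA't : CA' ≠ ⊤ := ENNReal.mul_ne_top hCA ENNReal.ofReal_ne_top
  -- (A₁) in the `ρ'`-exponent: `L^{1−2ρ} ≤ L^{1−2ρ'}` for `L ≥ 1`
  have hA1 : ∀ L : ℝ, 1 ≤ L → ∫⁻ y in ball (0 : EuclideanSpace ℝ (Fin 3)) L, ‖W y‖ₑ ^ 2 ≤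
      CA' * ENNReal.ofReal (L ^ (1 - 2 * ρ')) := by
    intro L hL
    refine (hA1ρ L hL).trans (mul_le_mul_right (ENNReal.ofReal_le_ofReal ?_) _)
    exact Real.rpow_le_rpow_of_exponent_le hL (by linarith)
  set CE' : ℝ≥0∞ := CE * ENNReal.ofReal ((2 - T₂) ^ (1 - ρ')) with hCE'
  set CD' : ℝ≥0∞ := CD * ENNReal.ofReal ((2 - T₂) ^ (2 - 2 * ρ')) with hCD'
  have hCE't : CE' ≠ ⊤ := ENNReal.mul_ne_top hCE ENNReal.ofReal_ne_top
  have hCD't : CD' ≠ ⊤ := ENNReal.mul_ne_top hCD ENNReal.ofReal_ne_top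
  set κE : ℝ := (1 - ρ') / (2 + ρ') with hκE
  set κD : ℝ := (2 - 2 * ρ') / (2 + ρ') with hκD
  have hκE0 : 0 < κE := by rw [hκE]; exact div_pos (by linarith) h2ρ'
  have hκD0 : 0 < κD := by rw [hκD]; exact div_pos (by linarith) h2ρ'
  set a : ℝ := CA'.toReal with ha
  set e : ℝ := CE'.toReal with he
  set d : ℝ := CD'.toReal with hd
  have ha0 : 0 ≤ a := ENNReal.toReal_nonneg
  have he0 : 0 ≤ e := ENNReal.toReal_nonneg
  have hd0 : 0 ≤ d := ENNReal.toReal_nonneg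
  set c₀ : ℝ := a + e / κE + d / κD with hc₀
  have hc₀0 : 0 ≤ c₀ := by positivity
  set c' : ℝ≥0 := c₀.toNNReal with hc'
  have hcc : (c' : ℝ≥0∞) = ENNReal.ofReal c₀ := rfl
  have haC : CA' = ENNReal.ofReal a := (ENNReal.ofReal_toReal hCA't).symm
  have heC : CE' = ENNReal.ofReal e := (ENNReal.ofReal_toReal hCE't).symm
  have hdC : CD' = ENNReal.ofReal d := (ENNReal.ofReal_toReal hCD't).symm
  have hAle : CA' ≤ (c' : ℝ≥0∞) := by
    rw [haC, hcc]
    refine ENNReal.ofReal_le_ofReal ?_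
    have : 0 ≤ e / κE + d / κD := by positivity
    rw [hc₀]; linarith
  have hEle : CE' ≤ ENNReal.ofReal κE * (c' : ℝ≥0∞) := by
    rw [heC, hcc, ← ENNReal.ofReal_mul hκE0.le]
    refine ENNReal.ofReal_le_ofReal ?_
    have h1 : κE * (e / κE) = e := mul_div_cancel₀ e hκE0.ne'
    have h2 : 0 ≤ κE * a + κE * (d / κD) := by positivity
    rw [hc₀]; nlinarith [h1, h2]
  have hDle : CD' ≤ ENNReal.ofReal κD * (c' : ℝ≥0∞) := by
    rw [hdC, hcc, ← ENNReal.ofReal_mul hκD0.le]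
    refine ENNReal.ofReal_le_ofReal ?_
    have h1 : κD * (d / κD) = d := mul_div_cancel₀ d hκD0.ne'
    have h2 : 0 ≤ κD * a + κD * (e / κE) := by positivity
    rw [hc₀]; nlinarith [h1, h2]
  refine ⟨G, c', CA', hWm, hPm, hGm, hWG, fun L hL => (hA1 L hL).trans (mul_le_mul' hAle le_rfl),
    fun L hL => (hE1 L hL).trans ?_, fun L hL => (hD1 L hL).trans ?_, hPoisson, hEE, hCA't, hA1ρ⟩
  · rw [mul_comm]; exact mul_le_mul' le_rfl hEle
  · rw [mul_comm]; exact mul_le_mul' le_rfl hDle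

/-! ### Rate rigidity for past-exact members -/

/-- **PAST-EXACT OFF-RATE SELF-SIMILAR MEMBERS IN THE WINDOW ARE TRIVIAL.**  Crux hypotheses verbatim (`0 < ρ ≤ ½`) + exact self-similarity of
`(u, p)` about `(T, x₀)` at a rate `g` with `1/(2+ρ) < g < ½`, FOR `τ < T₁` ONLY (`T₁ ≤ 0`, `T₁ ≤ T`; binder shape of the lead skeleton's
`IsPastSelfSimilar` with `1/(2+ρ) ↦ g`) ⇒ `u = 0` a.e. on `(−∞,0) × ℝ³` — NO hypothesis on the profile.  `T₁ = 0`, `T = 0`, `x₀ = 0` is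
`OffRate.selfSimilar_ae_eq_zero_of_rate_window`. [folklore; cf. BronziShvydkoy2015 Thm 1.1] -/
theorem selfSimilar_ae_eq_zero_of_rate_window_past (hρ : 0 < ρ) (hρh : ρ ≤ 1 / 2) (hT₁ : T₁ ≤ 0) (hTT₁ : T₁ ≤ T)
    (x₀ : EuclideanSpace ℝ (Fin 3))
    (hsw : IsSuitableWeakSolutionOn (slab (EuclideanSpace ℝ (Fin 3)) (Iio 0) isOpen_Iio) 0 0 u p)
    (hH : HasWeakSpatialGradientOn (slab (EuclideanSpace ℝ (Fin 3)) (Iio 0) isOpen_Iio) u H)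
    (hgauge : ∀ a : ℝ, 0 < a →
      ENNReal.ofReal (a ^ (2 * ρ)) * cknA a (0 : ℝ × EuclideanSpace ℝ (Fin 3)) u +
          ENNReal.ofReal (a ^ ρ) * cknE a (0 : ℝ × EuclideanSpace ℝ (Fin 3)) H +
        ENNReal.ofReal (a ^ (2 * ρ)) * cknD a (0 : ℝ × EuclideanSpace ℝ (Fin 3)) p ≤ (c : ℝ≥0∞))
    (hg1 : 1 / (2 + ρ) < g) (hg2 : g < 1 / 2)
    (hu : ∀ τ : ℝ, τ < T₁ → u τ = fun x => selfSimilarCollapse g T W τ (x - x₀))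
    (hp : ∀ τ : ℝ, τ < T₁ → p τ = fun x => selfSimilarCollapsePressure g T P τ (x - x₀)) :
    uncurry u =ᵐ[volume.restrict (Iio (0 : ℝ) ×ˢ (univ : Set (EuclideanSpace ℝ (Fin 3))))] 0 := by
  have hρ1 : ρ < 1 := by linarith
  obtain ⟨hρ'0, hρ'ρ, hρ'1, -⟩ := exponent_facts hρ hρ1 hg1 hg2
  obtain ⟨G, c', CA, hWm, hPm, hGm, hWG, hA₁, hE₁, hD₁, hPoisson, hEE, hCA, hA0⟩ :=
    exists_locData_past hρ hρh hT₁ hTT₁ x₀ hsw hH hgauge hg1 hg2 hu hp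
  -- ### sub-extremality in the `ρ'`-normalisation is automatic
  have hsub : ∀ ε : ℝ, 0 < ε → ∀ L₀ : ℝ, ∃ L : ℝ, L₀ ≤ L ∧
      L ^ (2 * (1 / g - 2) - 1) * ∫ y in ball (0 : EuclideanSpace ℝ (Fin 3)) L, ‖W y‖ ^ 2 < ε := by
    intro ε hε L₀
    set A : ℝ := CA.toReal with hAdef
    have hA0' : 0 ≤ A := ENNReal.toReal_nonneg
    have hCAeq : CA = ENNReal.ofReal A := (ENNReal.ofReal_toReal hCA).symm
    have htend : Tendsto (fun L : ℝ => L ^ (-(2 * (ρ - (1 / g - 2)))) * A) atTop (𝓝 (0 * A)) :=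
      (tendsto_rpow_neg_atTop (by linarith)).mul_const _
    rw [zero_mul] at htend
    obtain ⟨L, hLε, hLge⟩ := ((htend.eventually (gt_mem_nhds hε)).and (eventually_ge_atTop (max L₀ 1))).exists
    have hL1 : 1 ≤ L := (le_max_right _ _).trans hLge
    have hL0 : 0 < L := by linarith
    refine ⟨L, (le_max_left _ _).trans hLge, lt_of_le_of_lt ?_ hLε⟩
    have hball : ∫ y in ball (0 : EuclideanSpace ℝ (Fin 3)) L, ‖W y‖ ^ 2 ≤ A * L ^ (1 - 2 * ρ) := by
      refine integral_ball_norm_sq_le hWm (by positivity) ?_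
      rw [ENNReal.ofReal_mul hA0', ← hCAeq]
      exact hA0 L hL1
    calc L ^ (2 * (1 / g - 2) - 1) * ∫ y in ball (0 : EuclideanSpace ℝ (Fin 3)) L, ‖W y‖ ^ 2
        ≤ L ^ (2 * (1 / g - 2) - 1) * (A * L ^ (1 - 2 * ρ)) :=
          mul_le_mul_of_nonneg_left hball (Real.rpow_nonneg hL0.le _)
      _ = L ^ (-(2 * (ρ - (1 / g - 2)))) * A := by
          rw [show L ^ (2 * (1 / g - 2) - 1) * (A * L ^ (1 - 2 * ρ)) =
              L ^ (2 * (1 / g - 2) - 1) * L ^ (1 - 2 * ρ) * A by ring, ← Real.rpow_add hL0]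
          congr 2
          ring
  have hW0 : W =ᵐ[volume] 0 :=
    EnergySaturation.ae_eq_zero_of_subExtremal_loc hρ'0 hρ'1 hWm hPm hGm hWG hA₁ hE₁ hD₁ hPoisson hEE hsub
  exact Past.ae_eq_zero_of_profile_ae_eq_zero hρ.le hTT₁ hsw hH hgauge hu hW0

end OffRate

end Summit.NavierStokesRegularity.NavierStokesRegularity.Theorems.PowerGaugeEulerLiouville

end
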